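import Summits.QuantumFields.YangMills.Theorems.SwapVirialDeficitBlowUpGnomonicTipCaps
import HarnessLib

/-!
# The K7g group distance of the rotated tip point to its own base point, on cap 0

Sub-problem `SwapVirialDeficit`, crux ⟨stmt-QuantumFields-24197⟩ `SwapGluedStiffness`, skeleton ➎, stub `stub_core_tip`, socket (hCore).  The binder `hD` of w2 g61's
✓`abs_log_det_tip_mod_rot_group` / ✓`tip_follower_ceiling_mod_rot_group`, DELIVERED on cap 0: for the tip leader point over `p ≠ 0` with tilts
`|τ⃗|² + |ρ⃗|² ≤ 3`, `ζ = gnoRot ū η` (`rot3 u e₀ = (1,τ⃗)/λ`) and ITS OWN base point `gnoBase (ζ.x₀) (ζ.y₀)` (✓`tipRot_axial`: `= M·p`, `M` conformal-linear):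
★★★ `tip_cap0_groupDist_le` — for every `μ : Fin 4`,
`‖su2Quat C_μ(1; base) − su2Quat C_μ(1; ζ)‖ ≤ 2·√(900L⁶F̂(η)·(1+4|p|²)/|p|²) + √(3600L⁶F̂(η))`
(any hub `a ≠ 0` for `F̂`, any followers) — ✓`leaderGroupDist_le_apex` + ✓`tip_transverse_compressed_le` + ✓`gnoDeficit_floor_z` + the cap bound
`1 + |y|² ≤ 1 + 4|p|²` (`normSq3_cap0_le`).  Uniform in the tilts; the only `p`-dependence is the corner factor `(1+4|p|²)/|p|²`.

HONEST LABEL: letter bookkeeping only; (hCore), `stub_core_tip`, ⟨24197⟩, ⟨24194⟩ remain OPEN; nothing here proves the Yang–Mills mass gap.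
-/

noncomputable section

open MeasureTheory Quaternion Set
open scoped Quaternion BigOperators ENNReal
open Literature.MathematicalPhysics.QuantumLattice
open Literature.MathematicalPhysics.QuantumFieldTheory hiding SU2
open Literature.Analysis.Calculus (radialUnit radialUnit_def norm_radialUnit)

namespace Summit.QuantumFields.YangMills.Theorems.SwapVirialDeficit.BlowUpRing

open Summit.QuantumFields.YangMills.Theorems.FemtoTransferGap
open Summit.QuantumFields.YangMills.Theorems.FemtoTransferGap.TT
open Summit.QuantumFields.YangMills.Theorems.VirialFluxGap.RingDeficit
open Summit.QuantumFields.YangMills.Theorems.SwapVirialDeficit.SwapRing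
open Summit.QuantumFields.YangMills.Theorems.SwapVirialDeficit.Gnomonic (normSq3)

variable {L : ℕ} [NeZero L]

omit [NeZero L] in
/-- On cap 0 the letter sizes are at most `4|p|²`: `|x|² ≤ 4|p|²`, `|y|² ≤ 4|p|²` (`|u|² + |v|² = |p|²(|τ|²+|ρ|²) ≤ 3|p|²`). [folklore] -/
theorem normSq3_cap0_le (p : ℝ × ℝ) (τ ρ : Fin 2 → ℝ) (hcap : τ 0 ^ 2 + τ 1 ^ 2 + (ρ 0 ^ 2 + ρ 1 ^ 2) ≤ 3) :
    normSq3 (![p.1, p.1 * τ 0 - p.2 * ρ 0, p.1 * τ 1 - p.2 * ρ 1] : Fin 3 → ℝ) ≤ 4 * (p.1 ^ 2 + p.2 ^ 2) ∧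
      normSq3 (![p.2, p.2 * τ 0 + p.1 * ρ 0, p.2 * τ 1 + p.1 * ρ 1] : Fin 3 → ℝ) ≤ 4 * (p.1 ^ 2 + p.2 ^ 2) := by
  rw [normSq3_eq_three', normSq3_eq_three']
  simp only [Matrix.cons_val_zero, Matrix.cons_val_one, Matrix.head_cons, Matrix.cons_val_two, Matrix.tail_cons]
  have e : (p.1 * τ 0 - p.2 * ρ 0) ^ 2 + (p.1 * τ 1 - p.2 * ρ 1) ^ 2 + (p.2 * τ 0 + p.1 * ρ 0) ^ 2 + (p.2 * τ 1 + p.1 * ρ 1) ^ 2 =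
      (p.1 ^ 2 + p.2 ^ 2) * (τ 0 ^ 2 + τ 1 ^ 2 + (ρ 0 ^ 2 + ρ 1 ^ 2)) := by ring
  have hP : 0 ≤ p.1 ^ 2 + p.2 ^ 2 := by positivity
  have h3 : (p.1 ^ 2 + p.2 ^ 2) * (τ 0 ^ 2 + τ 1 ^ 2 + (ρ 0 ^ 2 + ρ 1 ^ 2)) ≤ (p.1 ^ 2 + p.2 ^ 2) * 3 := mul_le_mul_of_nonneg_left hcap hP
  constructor
  · nlinarith [sq_nonneg (p.2 * τ 0 + p.1 * ρ 0), sq_nonneg (p.2 * τ 1 + p.1 * ρ 1), sq_nonneg p.2]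
  · nlinarith [sq_nonneg (p.1 * τ 0 - p.2 * ρ 0), sq_nonneg (p.1 * τ 1 - p.2 * ρ 1), sq_nonneg p.1]

omit [NeZero L] in
/-- `√(2A/B) ≤ √(2C)` when `A/B ≤ C`. [folklore] -/
theorem sqrt_two_mul_div_le {A B C : ℝ} (h : A / B ≤ C) : Real.sqrt (2 * A / B) ≤ Real.sqrt (2 * C) := by
  refine Real.sqrt_le_sqrt ?_
  rw [mul_div_assoc]
  linarith

/-- ★★★ **THE K7g DISTANCE OF THE ROTATED TIP POINT TO ITS OWN BASE POINT, CAP 0**: see the module docstring. [cite: Luscher1983, §2] -/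
theorem tip_cap0_groupDist_le {a : ℍ} (ha : a ≠ 0) (ε : GnoSign L) {u : ℍ} (hu : ‖u‖ = 1) {p : ℝ × ℝ} (hp : 0 < p.1 ^ 2 + p.2 ^ 2) (τ ρ : Fin 2 → ℝ)
    (hcap : τ 0 ^ 2 + τ 1 ^ 2 + (ρ 0 ^ 2 + ρ 1 ^ 2) ≤ 3)
    (hrot : rot3 u ![1, 0, 0] = (Real.sqrt (1 + (τ 0 ^ 2 + τ 1 ^ 2)))⁻¹ • (![1, τ 0, τ 1] : Fin 3 → ℝ)) (z : Fin 3 → ℝ) (F : Fol L → Fin 3 → ℝ)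
    (μ : Fin 4) :
    ‖su2Quat ((blowUpPoint (L := L) 1 (gnomonicPoint ((1 : ℝ) : ℍ) ε
          (gnoBase ((gnoRot (star u) ((((![p.1, p.1 * τ 0 - p.2 * ρ 0, p.1 * τ 1 - p.2 * ρ 1] : Fin 3 → ℝ),
              (![p.2, p.2 * τ 0 + p.1 * ρ 0, p.2 * τ 1 + p.1 * ρ 1] : Fin 3 → ℝ)), (z, F)) : GnoCoord L)).1.1 0)
            ((gnoRot (star u) ((((![p.1, p.1 * τ 0 - p.2 * ρ 0, p.1 * τ 1 - p.2 * ρ 1] : Fin 3 → ℝ),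
              (![p.2, p.2 * τ 0 + p.1 * ρ 0, p.2 * τ 1 + p.1 * ρ 1] : Fin 3 → ℝ)), (z, F)) : GnoCoord L)).1.2 0)))).1 μ) -
        su2Quat ((blowUpPoint (L := L) 1 (gnomonicPoint ((1 : ℝ) : ℍ) ε
          (gnoRot (star u) ((((![p.1, p.1 * τ 0 - p.2 * ρ 0, p.1 * τ 1 - p.2 * ρ 1] : Fin 3 → ℝ),
              (![p.2, p.2 * τ 0 + p.1 * ρ 0, p.2 * τ 1 + p.1 * ρ 1] : Fin 3 → ℝ)), (z, F)) : GnoCoord L)))).1 μ)‖ ≤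
      2 * Real.sqrt (2 * (450 * (L : ℝ) ^ 6 * gnoDeficit (fun _ => false) (fun _ => 1) a ε
            ((((![p.1, p.1 * τ 0 - p.2 * ρ 0, p.1 * τ 1 - p.2 * ρ 1] : Fin 3 → ℝ),
              (![p.2, p.2 * τ 0 + p.1 * ρ 0, p.2 * τ 1 + p.1 * ρ 1] : Fin 3 → ℝ)), (z, F)) : GnoCoord L) *
            (1 + 4 * (p.1 ^ 2 + p.2 ^ 2)) / (p.1 ^ 2 + p.2 ^ 2))) +
        Real.sqrt (2 * (1800 * (L : ℝ) ^ 6 * gnoDeficit (fun _ => false) (fun _ => 1) a ε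
            ((((![p.1, p.1 * τ 0 - p.2 * ρ 0, p.1 * τ 1 - p.2 * ρ 1] : Fin 3 → ℝ),
              (![p.2, p.2 * τ 0 + p.1 * ρ 0, p.2 * τ 1 + p.1 * ρ 1] : Fin 3 → ℝ)), (z, F)) : GnoCoord L))) := by
  set x : Fin 3 → ℝ := ![p.1, p.1 * τ 0 - p.2 * ρ 0, p.1 * τ 1 - p.2 * ρ 1] with hx
  set y : Fin 3 → ℝ := ![p.2, p.2 * τ 0 + p.1 * ρ 0, p.2 * τ 1 + p.1 * ρ 1] with hy
  set η : GnoCoord L := (((x, y), (z, F)) : GnoCoord L) with hη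
  set ζ : GnoCoord L := gnoRot (star u) η with hζ
  set G : ℝ := gnoDeficit (fun _ => false) (fun _ => 1) a ε η with hG
  set P : ℝ := p.1 ^ 2 + p.2 ^ 2 with hP
  have hsu : ‖star u‖ = 1 := by rw [Quaternion.norm_star]; exact hu
  -- (1) w2's apex group distance at the base point of `ζ` itself
  have hD := leaderGroupDist_le_apex (L := L) ε ζ.1.1 ζ.1.2 ζ.2.1 ζ.2.2 0 μ
  have eζ : (((ζ.1.1, ζ.1.2), (ζ.2.1, ζ.2.2)) : GnoCoord L) = ζ := rfl
  have eb : ((((![ζ.1.1 0, 0, 0] : Fin 3 → ℝ), (![ζ.1.2 0, 0, 0] : Fin 3 → ℝ)), ((0 : Fin 3 → ℝ), (0 : Fol L → Fin 3 → ℝ))) : GnoCoord L) =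
      gnoBase (ζ.1.1 0) (ζ.1.2 0) := rfl
  rw [eζ, eb] at hD
  refine hD.trans ?_
  -- (2) the sizes: |ζ.x|² = |x|² ≤ 4P etc.
  obtain ⟨nX, nY, nZ⟩ := normSq3_gnoRot (L := L) hsu η
  rw [← hζ] at nX nY nZ
  have hx' : η.1.1 = x := rfl
  have hy' : η.1.2 = y := rfl
  have hz' : η.2.1 = z := rfl
  rw [hx'] at nX
  rw [hy'] at nY
  rw [hz'] at nZ
  obtain ⟨cX, cY⟩ := normSq3_cap0_le p τ ρ hcap
  rw [← hx] at cX
  rw [← hy] at cY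
  -- (3) the compressed transverse bounds (in the `gnoBase + gnoRot ū stiff` form of `ζ`)
  obtain ⟨tX, tY⟩ := tip_transverse_compressed_le (L := L) a ε hu hp τ ρ hrot z F
  rw [← tipRot_letters_of_rot (L := L) hu p τ ρ hrot z F] at tX tY
  change ((ζ.1.1 1) ^ 2 + (ζ.1.1 2) ^ 2) / (1 + normSq3 x) ≤ 450 * (L : ℝ) ^ 6 * G * (1 + normSq3 y) / P at tX
  change ((ζ.1.2 1) ^ 2 + (ζ.1.2 2) ^ 2) / (1 + normSq3 y) ≤ 450 * (L : ℝ) ^ 6 * G * (1 + normSq3 x) / P at tY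
  have hG0 : 0 ≤ G := gnoDeficit_nonneg _ _ _ _ _
  have hL6 : 0 ≤ 450 * (L : ℝ) ^ 6 * G := by positivity
  -- (4) the z floor
  have hZf := gnoDeficit_floor_z (L := L) ha ε η
  rw [hz'] at hZf
  change ((z 0) ^ 2 + (z 1) ^ 2 + (z 2) ^ 2) / (1 + ((z 0) ^ 2 + (z 1) ^ 2 + (z 2) ^ 2)) ≤ 1800 * (L : ℝ) ^ 6 * G at hZf
  -- (5) assemble
  have eSx : 1 + ((ζ.1.1 0) ^ 2 + (ζ.1.1 1) ^ 2 + (ζ.1.1 2) ^ 2) = 1 + normSq3 x := by rw [← normSq3_eq_three', nX]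
  have eSy : 1 + ((ζ.1.2 0) ^ 2 + (ζ.1.2 1) ^ 2 + (ζ.1.2 2) ^ 2) = 1 + normSq3 y := by rw [← normSq3_eq_three', nY]
  have eSz : (ζ.2.1 0) ^ 2 + (ζ.2.1 1) ^ 2 + (ζ.2.1 2) ^ 2 = (z 0) ^ 2 + (z 1) ^ 2 + (z 2) ^ 2 := by
    rw [← normSq3_eq_three', nZ, normSq3_eq_three']
  rw [eSx, eSy, eSz]
  have bX : ((ζ.1.1 1) ^ 2 + (ζ.1.1 2) ^ 2) / (1 + normSq3 x) ≤ 450 * (L : ℝ) ^ 6 * G * (1 + 4 * P) / P := by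
    refine tX.trans ?_
    rw [div_le_div_iff_of_pos_right hp]
    exact mul_le_mul_of_nonneg_left (by linarith) hL6
  have bY : ((ζ.1.2 1) ^ 2 + (ζ.1.2 2) ^ 2) / (1 + normSq3 y) ≤ 450 * (L : ℝ) ^ 6 * G * (1 + 4 * P) / P := by
    refine tY.trans ?_
    rw [div_le_div_iff_of_pos_right hp]
    exact mul_le_mul_of_nonneg_left (by linarith) hL6
  have sX := sqrt_two_mul_div_le bX
  have sY := sqrt_two_mul_div_le bY
  have sZ := sqrt_two_mul_div_le hZf
  linarith [sX, sY, sZ]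

end Summit.QuantumFields.YangMills.Theorems.SwapVirialDeficit.BlowUpRing

end
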